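import Mathlib
import Summits.NavierStokesRegularity.NavierStokesRegularity.Theorems.LerayQuarterDissipationFiniteDissipationLiouvilleVelocityLSixStretching
import Summits.NavierStokesRegularity.NavierStokesRegularity.Theorems.LerayQuarterDissipationFiniteDissipationLiouvilleVorticityLThree
import HarnessLib

/-!
# Crux `FiniteDissipationLiouville` (stmt-NavierStokesRegularity-22144): the `L⁶`-VELOCITY
# threshold — a finite-dissipation Type-I profile with `KS²·(−t)·‖V(t)‖⁴_{L⁶} < 64/27` for all
# `t < 0` is trivial (file 3/3)

Theorems file of route `LerayQuarterDissipation` (lead prover g16; `--supports` the crux; portrait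
fact for the registered stub `stub_envelopeCriticalLiouville` of skeleton `Lines/birth.lean`).
Navier–Stokes regularity is NOT proved by anything here; no summit is.

`𝒟_{C,K}`: Type-I ancient mild fields `V` in the KNSS gauge (`IsTypeIAncientMild C V`) whose
slices obey the quarter-rate dissipation law `∫ ‖DV(t)‖² ≤ K/√(−t)`. A FIFTH scale-invariant
parameter: the `L⁶`-VELOCITY constant `V₆ = sup_{t<0} (−t)^{1/4}‖V(t)‖_{L⁶(ℝ³)}`, in similarity
variables `sup_s ‖U(s)‖_{L⁶}` (`U = lerayOrbit V`, `∫‖U(s)‖⁶ = (−t)^{3/2}∫‖V(t)‖⁶`), finite on the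
stratum (`…SliceLSix.memLp_six_slice`). With `KS = SNormLESNormFDerivOfEqConst ℝ³ volume 2`:

* `lerayVorticity_eq_zero_of_pow_six_le`, **`eq_zero_of_velocityLSix_lt`** — a member of
  `𝒟_{C,K}` (ANY `C`, ANY `K`) with `∫⁻‖V(t)‖ₑ⁶ ≤ w⁶/(√(−t))³` for all `t < 0` (`w ≥ 0`) and
  `KS²w⁴ < 64/27` vanishes identically on `t < 0`: the stretching term priced `L⁶ × L³ × L²` after
  integration by parts (file 2/3), the dissipation consumed exactly, leaves
  `Z_R' ≤ −½Z_R + (27/128)(1+δ)KS²w⁴·Z_R + LM/R`; with `δ = (64 − 27q)/(64 + 27q)`, `q = KS²w⁴`,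
  the sup-iteration contracts by `54q/(64 + 27q) < 1`.
* `not_singular_of_velocityLSix_lt`, **`velocityLSix_exceeds_of_singular`** — regularity form and
  PORTRAIT: a SINGULAR member has, for every `w ≥ 0` with `KS²w⁴ < 64/27`, an instant with
  `(−t)^{3/2}∫‖V(t)‖⁶ > w⁶`, i.e. `sup_t (−t)^{1/4}‖V(t)‖_{L⁶} ≥ (64/27)^{1/4}/√KS`.

STRUCTURAL REMARK (the point of this file). By the Sobolev inequality `‖U‖₆ ≤ KS‖DU‖₂` and the law
`∫‖DU(s)‖² ≤ K`, `KS²V₆⁴ ≤ KS⁶K² = θ(K)⁴` — so lead g14's explicit small-DISSIPATION rung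
`θ(K)⁴ < 64/27 ⇒ V ≡ 0` (`…SmallDissipationGapSharper`) is the Sobolev shadow of the present
`L⁶`-VELOCITY rung with the SAME number `64/27`: the dissipation constant enters that chain only
through `‖U‖₆`. Next to the `L^∞` velocity threshold `√(−t)‖V‖_∞ ≥ 1` (T31⁗/`…ThresholdOne`) the
line now has an `L⁶` velocity threshold, and neither smallness implies the other.

HONEST FRAMING. An explicit necessary condition on the HYPOTHETICAL singular profile with Mathlib's
non-sharp Sobolev constant; the formal corollary `θ(K)⁴ < 64/27 ⇒ KS²V₆⁴ < 64/27` needs the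
Gagliardo–Nirenberg–Sobolev inequality for `L⁶` (not `L²`) fields, which the tree's
`SobolevWholeSpace` does not state — it is recorded here as a remark, the small-`K` rung being a
theorem already; nothing is removed from the catalogued DSS wall (`TypeIDSSLiouville`, NECESSARY for
the crux); nothing here bears on Navier–Stokes regularity or blow-up.

References: Koch–Nadirashvili–Seregin–Šverák, Acta Math. 203 (2009) §4–§6; Ladyzhenskaya 1969 §1.1;
Evans 2010 §5.6.1; folklore energy method.
-/

noncomputable section

set_option linter.dupNamespace false

namespace Summit.NavierStokesRegularity.NavierStokesRegularity.Theorems.FiniteDissipationLiouville.VelocityLSix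

open MeasureTheory Set Filter Topology Metric InnerProductSpace Function Real
open scoped RealInnerProductSpace ContDiff ENNReal Laplacian
open Literature.Analysis Literature.Analysis.FluidPDE
open Summit.NavierStokesRegularity.NavierStokesRegularity.Theorems
open Summit.NavierStokesRegularity.NavierStokesRegularity.Theorems.GaussianGap
open Summit.NavierStokesRegularity.NavierStokesRegularity.Theorems.SimilarityEnstrophy
open Summit.NavierStokesRegularity.NavierStokesRegularity.Theorems.SmallDissipationGap
open Summit.NavierStokesRegularity.NavierStokesRegularity.Theorems.FiniteDissipationLiouville.VorticityAmplitude
open Summit.NavierStokesRegularity.NavierStokesRegularity.Theorems.FiniteDissipationLiouville.VorticityLThree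

variable {C : ℝ} {V : ℝ → (EuclideanSpace ℝ (Fin 3)) → (EuclideanSpace ℝ (Fin 3))}

/-! ### The core in similarity variables -/

section Core

/-- **The similarity vorticity vanishes below the `L⁶`-velocity threshold (similarity form).** For
`V ∈ 𝒟_{C,K}` (any `C`, any `K`) whose similarity slices satisfy `‖U(σ)‖⁶ ∈ L¹`, `∫‖U(σ)‖⁶ ≤ w⁶`
for all `σ` (`w ≥ 0`) with `q = KS²w⁴ < 64/27`: `Ω ≡ 0`. With `δ = (64 − 27q)/(64 + 27q)` the
contraction ratio is `2a = (27/64)(1+δ)q = 54q/(64 + 27q) < 1`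
(`two_mul_integral_sqCutoff_stretching_le_lsix` + `integral_sq_norm_lerayVorticity_le_of_forall_one_le`).
[folklore energy method; Gagliardo–Nirenberg–Sobolev] -/
theorem lerayVorticity_eq_zero_of_pow_six_le (hV : IsTypeIAncientMild C V) {K : ℝ}
    (hK : ∀ t : ℝ, t < 0 → ∫⁻ x, ‖fderiv ℝ (V t) x‖ₑ ^ 2 ≤ ENNReal.ofReal (K / Real.sqrt (-t)))
    {w : ℝ} (hw : 0 ≤ w)
    (hq : (SNormLESNormFDerivOfEqConst (EuclideanSpace ℝ (Fin 3))
        (volume : Measure (EuclideanSpace ℝ (Fin 3))) 2 : ℝ) ^ 2 * w ^ 4 < 64 / 27)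
    (hU6 : ∀ σ : ℝ, Integrable (fun y => ‖lerayOrbit V σ y‖ ^ 6) ∧
      ∫ y, ‖lerayOrbit V σ y‖ ^ 6 ≤ w ^ 6) :
    ∀ s y, lerayVorticity V s y = 0 := by
  set KS : ℝ := (SNormLESNormFDerivOfEqConst (EuclideanSpace ℝ (Fin 3))
        (volume : Measure (EuclideanSpace ℝ (Fin 3))) 2 : ℝ) with hKSdef
  have hΩi := fun σ => integrable_sq_norm_lerayVorticity hV hK σ
  obtain ⟨c₁, hc₁0, hc₁⟩ :=
    exists_norm_fderiv_smoothTransition_cutoff_le (E := (EuclideanSpace ℝ (Fin 3)))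
  have hC : 0 ≤ C := hV.nonneg
  set M : ℝ := ‖curlCLM‖ ^ 2 * max K 0 with hMdef
  set q : ℝ := KS ^ 2 * w ^ 4 with hqdef
  have hq0 : 0 ≤ q := by positivity
  have hq1 : 27 * q < 64 := by rw [hqdef]; linarith
  set δ : ℝ := (64 - 27 * q) / (64 + 27 * q) with hδdef
  have hδ : 0 < δ := div_pos (by linarith) (by linarith)
  set a : ℝ := 27 / 128 * (1 + δ) * KS ^ 2 * w ^ 4 with hadef
  have ha0 : 0 ≤ a := by positivity
  set r : ℝ := 2 * (a + 0) with hrdef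
  have hr0 : 0 ≤ r := by positivity
  have hr1 : r < 1 := by
    have h64 : (64 + 27 * q) ≠ 0 := by positivity
    have e : r = 54 * q / (64 + 27 * q) := by
      rw [hrdef, hadef, hδdef,
        show 27 / 128 * (1 + (64 - 27 * q) / (64 + 27 * q)) * KS ^ 2 * w ^ 4 =
          27 / 128 * (1 + (64 - 27 * q) / (64 + 27 * q)) * q by rw [hqdef]; ring]
      field_simp
      ring
    rw [e, div_lt_one (by linarith)]
    linarith
  have hstr : ∀ σ : ℝ, ∀ R : ℝ, 1 ≤ R →
      2 * (∫ y, smoothTransition (2 - ‖y‖ ^ 2 / R ^ 2) ^ 2 *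
        ⟪fderiv ℝ (lerayOrbit V σ) y (lerayVorticity V σ y), lerayVorticity V σ y⟫) ≤
        2 * (∫ y, smoothTransition (2 - ‖y‖ ^ 2 / R ^ 2) ^ 2 *
            frobeniusNormSq (fderiv ℝ (lerayVorticity V σ) y)) +
          a * (∫ y, smoothTransition (2 - ‖y‖ ^ 2 / R ^ 2) ^ 2 * ‖lerayVorticity V σ y‖ ^ 2) +
          0 * (∫ y, ‖lerayVorticity V σ y‖ ^ 2) +
          (2 * c₁ ^ 2 / δ + 4 * C * c₁) / R *
            ∫ y in closedBall (0 : EuclideanSpace ℝ (Fin 3)) (2 * R), ‖lerayVorticity V σ y‖ ^ 2 :=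
    fun σ R hR1 => two_mul_integral_sqCutoff_stretching_le_lsix hV hc₁ hR1 σ hw (hU6 σ).1
      (hU6 σ).2 hδ
  have hiter : ∀ n : ℕ, ∀ s, ∫ y, ‖lerayVorticity V s y‖ ^ 2 ≤ r ^ n * M := by
    intro n
    induction n with
    | zero => intro s; rw [pow_zero, one_mul]; exact (hΩi s).2
    | succ n ih =>
        intro s
        calc ∫ y, ‖lerayVorticity V s y‖ ^ 2 ≤ 2 * (a + 0) * (r ^ n * M) :=
              integral_sq_norm_lerayVorticity_le_of_forall_one_le hV hK ha0 le_rfl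
                (by positivity) hstr ih s
          _ = r ^ (n + 1) * M := by rw [hrdef]; ring
  have hlim : Tendsto (fun n : ℕ => r ^ n * M) atTop (𝓝 (0 * M)) :=
    (tendsto_pow_atTop_nhds_zero_of_lt_one hr0 hr1).mul_const M
  rw [zero_mul] at hlim
  intro s
  have hcΩ : Continuous (lerayVorticity V s) :=
    (signedBudget_contDiff_lerayVorticity_slice hV s (n := 1)).continuous
  have hE0 : ∫ y, ‖lerayVorticity V s y‖ ^ 2 ≤ 0 := ge_of_tendsto' hlim fun n => hiter n s
  have hE : ∫ y, ‖lerayVorticity V s y‖ ^ 2 = 0 :=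
    le_antisymm hE0 (integral_nonneg fun y => sq_nonneg _)
  have hae : (fun y => ‖lerayVorticity V s y‖ ^ 2) =ᵐ[volume] 0 :=
    (integral_eq_zero_iff_of_nonneg (fun y => sq_nonneg _) (hΩi s).1).1 hE
  have hev : (fun y => ‖lerayVorticity V s y‖ ^ 2) = fun _ => (0 : ℝ) :=
    ((hcΩ.norm.pow 2).ae_eq_iff_eq (μ := volume) continuous_const).1 hae
  intro y
  have hy := congrFun hev y
  have : ‖lerayVorticity V s y‖ = 0 := pow_eq_zero_iff (n := 2) (by norm_num) |>.1 hy
  exact norm_eq_zero.1 this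

end Core

/-! ### The rung in the physical `L⁶`-velocity parameter -/

section Rung

/-- **The `L⁶`-velocity rung of the finite-dissipation stratum.** A Type-I ancient mild solution `V`
in the KNSS gauge (any constant `C`) obeying the quarter-rate dissipation law (any constant `K`) with
`∫⁻‖V(t)‖ₑ⁶ ≤ w⁶/(√(−t))³` for all `t < 0` — i.e. `(−t)^{1/4}‖V(t)‖_{L⁶} ≤ w`, `w ≥ 0` — and
`KS²w⁴ < 64/27` vanishes identically on `t < 0` (`integrable_pow_six_norm_lerayOrbit_of_law` +
`lerayVorticity_eq_zero_of_pow_six_le` + `…VorticityLThree.eq_zero_of_lerayVorticity_eq_zero`).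
HONEST FRAMING: a Liouville statement about a HYPOTHETICAL class with an explicit, unoptimised
constant; nothing here bears on NS regularity. [folklore energy method] -/
theorem eq_zero_of_velocityLSix_lt (hV : IsTypeIAncientMild C V) {K : ℝ}
    (hK : ∀ t : ℝ, t < 0 → ∫⁻ x, ‖fderiv ℝ (V t) x‖ₑ ^ 2 ≤ ENNReal.ofReal (K / Real.sqrt (-t)))
    {w : ℝ} (hw : 0 ≤ w)
    (hq : (SNormLESNormFDerivOfEqConst (EuclideanSpace ℝ (Fin 3))
        (volume : Measure (EuclideanSpace ℝ (Fin 3))) 2 : ℝ) ^ 2 * w ^ 4 < 64 / 27)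
    (hu : ∀ t : ℝ, t < 0 → ∫⁻ x, ‖V t x‖ₑ ^ 6 ≤ ENNReal.ofReal (w ^ 6 / Real.sqrt (-t) ^ 3)) :
    ∀ t < 0, ∀ x, V t x = 0 :=
  eq_zero_of_lerayVorticity_eq_zero hV (lerayVorticity_eq_zero_of_pow_six_le hV hK hw hq
    fun σ => integrable_pow_six_norm_lerayOrbit_of_law hV hu σ)

/-- **Regularity form.** Under the same hypotheses `V` is bounded on a backward parabolic cylinder
at the space–time origin (indeed `V ≡ 0`), in the quantifier shape of the crux
`FiniteDissipationLiouville`. [folklore] -/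
theorem not_singular_of_velocityLSix_lt (hV : IsTypeIAncientMild C V) {K : ℝ}
    (hK : ∀ t : ℝ, t < 0 → ∫⁻ x, ‖fderiv ℝ (V t) x‖ₑ ^ 2 ≤ ENNReal.ofReal (K / Real.sqrt (-t)))
    {w : ℝ} (hw : 0 ≤ w)
    (hq : (SNormLESNormFDerivOfEqConst (EuclideanSpace ℝ (Fin 3))
        (volume : Measure (EuclideanSpace ℝ (Fin 3))) 2 : ℝ) ^ 2 * w ^ 4 < 64 / 27)
    (hu : ∀ t : ℝ, t < 0 → ∫⁻ x, ‖V t x‖ₑ ^ 6 ≤ ENNReal.ofReal (w ^ 6 / Real.sqrt (-t) ^ 3)) :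
    ¬ (∀ r > 0, ∀ M : ℝ, ∃ t ∈ Set.Ioo (-(r ^ 2)) (0 : ℝ),
        ∃ x ∈ Metric.ball (0 : EuclideanSpace ℝ (Fin 3)) r, M < ‖V t x‖) := by
  intro hsing
  obtain ⟨t, ht, x, -, hM⟩ := hsing 1 one_pos 0
  have h0 := eq_zero_of_velocityLSix_lt hV hK hw hq hu t ht.2 x
  rw [h0, norm_zero] at hM
  exact lt_irrefl _ hM

/-- **PORTRAIT: the `L⁶` norm of a finite-dissipation Type-I singularity reaches
`((64/27)^{1/4}/√KS)·(−t)^{−1/4}`.** A SINGULAR member of `𝒟_{C,K}` (any `C`, `K`) has, for every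
`w ≥ 0` with `KS²w⁴ < 64/27`, an instant `t < 0` with `∫⁻‖V(t)‖ₑ⁶ > w⁶/(√(−t))³`, i.e.
`(−t)^{1/4}‖V(t)‖_{L⁶} > w` — the `L⁶` companion of the `L^∞` velocity floor `√(−t)‖V‖_∞ ≥ 1`;
by Sobolev it contains lead g14's dissipation floor `θ(K)⁴ ≥ 64/27`. No DSS scenario of the
catalogued wall is removed. [folklore] -/
theorem velocityLSix_exceeds_of_singular (hV : IsTypeIAncientMild C V) {K : ℝ}
    (hK : ∀ t : ℝ, t < 0 → ∫⁻ x, ‖fderiv ℝ (V t) x‖ₑ ^ 2 ≤ ENNReal.ofReal (K / Real.sqrt (-t)))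
    (hsing : ∀ r > 0, ∀ M : ℝ, ∃ t ∈ Set.Ioo (-(r ^ 2)) (0 : ℝ),
        ∃ x ∈ Metric.ball (0 : EuclideanSpace ℝ (Fin 3)) r, M < ‖V t x‖)
    {w : ℝ} (hw : 0 ≤ w)
    (hq : (SNormLESNormFDerivOfEqConst (EuclideanSpace ℝ (Fin 3))
        (volume : Measure (EuclideanSpace ℝ (Fin 3))) 2 : ℝ) ^ 2 * w ^ 4 < 64 / 27) :
    ∃ t : ℝ, t < 0 ∧ ENNReal.ofReal (w ^ 6 / Real.sqrt (-t) ^ 3) < ∫⁻ x, ‖V t x‖ₑ ^ 6 := by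
  by_contra h
  push Not at h
  exact not_singular_of_velocityLSix_lt hV hK hw hq (fun t ht => h t ht) hsing

end Rung

end Summit.NavierStokesRegularity.NavierStokesRegularity.Theorems.FiniteDissipationLiouville.VelocityLSix

end
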